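import Literature.Topology.FourManifolds.TautFoliationsContourSquareFloor
import Mathlib.Topology.Order.MonotoneContinuity
import Mathlib.Topology.Piecewise
import Mathlib.Topology.OpenPartialHomeomorph.Constructions
import HarnessLib

/-!
# The contour chart across a roof–floor edge

Topic: sequel to `TautFoliationsContourSquare(Floor).lean`, the key regularity statement of the
**checkerboard** choice of apexes in the cone position of a disc: across the common edge `E` of
a square `Q = closedBall c ℓ` with a **roof** apex (`ψ < m` on `∂Q`) and its right neighbour
`Q' = closedBall c' ℓ`, `c' = c + (2ℓ, 0)`, with a **floor** apex (`m' < ψ'` on `∂Q'`), the glued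
height `Ĥ` (`= coneHt` on `Q`, `= σ ∘ coneHt'` on `Q'`, where the increasing homeomorphism `σ`
converts `Q'`-heights into `Q`-heights and `ψ = σ ∘ ψ'` on `E`) has **no singularity on the
open edge**, whatever the boundary heights: in the cone coordinates `(q, h)`, `q ∈ E`, the
`Q`-side is the region `h ≥ ψ q` and the `Q'`-side the region `h ≤ ψ q`, which glue to a full
neighbourhood, the contour lines becoming `h = const`.

* `ConeSquare.edgeDiamond c ℓ` (**definition**): the open square with diagonal `E`
  (`|x.2 - c.2| < min (x.1 - c.1) (c.1 + 2ℓ - x.1)`), union of the two fans of `E` from the two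
  centres;
* `ConeSquare.edgeChart` (**definition**): the open partial homeomorphism
  `x ↦ ((P x).2, Ĥ x)` (`P` = projection from the centre of the side of `x`) of the diamond
  onto the open rectangle `(c.2 - ℓ, c.2 + ℓ) × (σ m', m)`, with inverse
  `(s, h) ↦ levelPt c m ψ (c.1 + ℓ, s) h` if `ψ (c.1 + ℓ, s) ≤ h`, else
  `levelPt c' m' ψ' (c.1 + ℓ, s) (σ⁻¹ h)`; `edgeChart_snd`: its height coordinate is `Ĥ`.

All statements are [folklore] (elementary real analysis).
-/

noncomputable section

open Set Filter Metric Topology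

namespace Literature.Topology.FourManifolds

namespace ConeSquare

variable {c : ℝ × ℝ} {ℓ m m' : ℝ} {ψ ψ' : ℝ × ℝ → ℝ} {σ : ℝ ≃o ℝ} {x : ℝ × ℝ} {s h : ℝ}

/-! ## The fans of the right edge -/

/-- The centre of the right neighbour. [folklore] -/
def rightCenter (c : ℝ × ℝ) (ℓ : ℝ) : ℝ × ℝ := (c.1 + 2 * ℓ, c.2)

/-- The point of the right edge of `Q` (= left edge of `Q'`) at ordinate `s`. [folklore] -/
def edgePt (c : ℝ × ℝ) (ℓ s : ℝ) : ℝ × ℝ := (c.1 + ℓ, s)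

/-- **The open diamond with diagonal the open edge.** [folklore] -/
def edgeDiamond (c : ℝ × ℝ) (ℓ : ℝ) : Set (ℝ × ℝ) := {x | |x.2 - c.2| < min (x.1 - c.1) (c.1 + 2 * ℓ - x.1)}

/-- The diamond is open. [folklore] -/
theorem isOpen_edgeDiamond (c : ℝ × ℝ) (ℓ : ℝ) : IsOpen (edgeDiamond c ℓ) :=
  isOpen_lt (by fun_prop) (by fun_prop)

/-- An edge point at ordinate `s`, `|s - c.2| < ℓ`, is on the boundary of `Q`. [folklore] -/
theorem edgePt_mem_sphere (hℓ : 0 < ℓ) (hs : s ∈ Ioo (c.2 - ℓ) (c.2 + ℓ)) : edgePt c ℓ s ∈ sphere c ℓ := by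
  rw [mem_sphere, Prod.dist_eq, edgePt, Real.dist_eq, Real.dist_eq]
  simp only
  rw [show c.1 + ℓ - c.1 = ℓ by ring, abs_of_pos hℓ]
  exact max_eq_left (abs_le.2 ⟨by linarith [hs.1], by linarith [hs.2]⟩)

/-- An edge point is on the boundary of `Q'`. [folklore] -/
theorem edgePt_mem_sphere' (hℓ : 0 < ℓ) (hs : s ∈ Ioo (c.2 - ℓ) (c.2 + ℓ)) : edgePt c ℓ s ∈ sphere (rightCenter c ℓ) ℓ := by
  rw [mem_sphere, Prod.dist_eq, edgePt, rightCenter, Real.dist_eq, Real.dist_eq]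
  simp only
  rw [show c.1 + ℓ - (c.1 + 2 * ℓ) = -ℓ by ring, abs_neg, abs_of_pos hℓ]
  exact max_eq_left (abs_le.2 ⟨by linarith [hs.1], by linarith [hs.2]⟩)

/-- **Left fan**: a point of the diamond with `x.1 ≤ c.1 + ℓ` is in `Q`, off the centre, at
distance `x.1 - c.1` from `c`, and projects to the open right edge at ordinate
`c.2 + ℓ (x.2 - c.2) / (x.1 - c.1)`. [folklore] -/
theorem left_fan (hℓ : 0 < ℓ) (hx : x ∈ edgeDiamond c ℓ) (hside : x.1 ≤ c.1 + ℓ) :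
    dist x c = x.1 - c.1 ∧ 0 < x.1 - c.1 ∧ x ∈ closedBall c ℓ ∧ x ≠ c ∧
      proj c ℓ x = edgePt c ℓ (c.2 + ℓ * (x.2 - c.2) / (x.1 - c.1)) ∧
      c.2 + ℓ * (x.2 - c.2) / (x.1 - c.1) ∈ Ioo (c.2 - ℓ) (c.2 + ℓ) := by
  have hx' : |x.2 - c.2| < x.1 - c.1 := lt_of_lt_of_le hx (min_le_left _ _)
  have hpos : 0 < x.1 - c.1 := (abs_nonneg _).trans_lt hx'
  have hdist : dist x c = x.1 - c.1 := by
    rw [Prod.dist_eq, Real.dist_eq, Real.dist_eq, abs_of_pos hpos]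
    exact max_eq_left hx'.le
  have hxc : x ≠ c := fun h ↦ by rw [h, sub_self] at hpos; exact lt_irrefl _ hpos
  refine ⟨hdist, hpos, by rw [mem_closedBall, hdist]; linarith, hxc, ?_, ?_⟩
  · rw [proj_of_ne hxc, hdist, edgePt]
    ext
    · show c.1 + ℓ / (x.1 - c.1) * (x.1 - c.1) = c.1 + ℓ
      rw [div_mul_cancel₀ _ hpos.ne']
    · show c.2 + ℓ / (x.1 - c.1) * (x.2 - c.2) = c.2 + ℓ * (x.2 - c.2) / (x.1 - c.1)
      rw [div_mul_eq_mul_div]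
  · rw [abs_lt] at hx'
    constructor
    · have : -ℓ < ℓ * (x.2 - c.2) / (x.1 - c.1) := by
        rw [lt_div_iff₀ hpos]; nlinarith
      linarith
    · have : ℓ * (x.2 - c.2) / (x.1 - c.1) < ℓ := by
        rw [div_lt_iff₀ hpos]; nlinarith
      linarith

/-- **Right fan**: a point of the diamond with `c.1 + ℓ ≤ x.1` is in `Q'`, off its centre, and
projects from `c'` to the open edge at ordinate `c.2 + ℓ (x.2 - c.2) / (c.1 + 2ℓ - x.1)`.
[folklore] -/
theorem right_fan (hℓ : 0 < ℓ) (hx : x ∈ edgeDiamond c ℓ) (hside : c.1 + ℓ ≤ x.1) :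
    dist x (rightCenter c ℓ) = c.1 + 2 * ℓ - x.1 ∧ 0 < c.1 + 2 * ℓ - x.1 ∧ x ∈ closedBall (rightCenter c ℓ) ℓ ∧
      x ≠ rightCenter c ℓ ∧
      proj (rightCenter c ℓ) ℓ x = edgePt c ℓ (c.2 + ℓ * (x.2 - c.2) / (c.1 + 2 * ℓ - x.1)) ∧
      c.2 + ℓ * (x.2 - c.2) / (c.1 + 2 * ℓ - x.1) ∈ Ioo (c.2 - ℓ) (c.2 + ℓ) := by
  have hx' : |x.2 - c.2| < c.1 + 2 * ℓ - x.1 := lt_of_lt_of_le hx (min_le_right _ _)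
  have hpos : 0 < c.1 + 2 * ℓ - x.1 := (abs_nonneg _).trans_lt hx'
  have hdist : dist x (rightCenter c ℓ) = c.1 + 2 * ℓ - x.1 := by
    rw [Prod.dist_eq, rightCenter, Real.dist_eq, Real.dist_eq]
    simp only
    rw [show x.1 - (c.1 + 2 * ℓ) = -(c.1 + 2 * ℓ - x.1) by ring, abs_neg, abs_of_pos hpos]
    exact max_eq_left hx'.le
  have hxc : x ≠ rightCenter c ℓ := fun h ↦ by
    rw [h, rightCenter] at hpos; simp only at hpos; linarith
  refine ⟨hdist, hpos, by rw [mem_closedBall, hdist]; linarith, hxc, ?_, ?_⟩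
  · rw [proj_of_ne hxc, hdist, edgePt, rightCenter]
    ext
    · show c.1 + 2 * ℓ + ℓ / (c.1 + 2 * ℓ - x.1) * (x.1 - (c.1 + 2 * ℓ)) = c.1 + ℓ
      rw [show x.1 - (c.1 + 2 * ℓ) = -(c.1 + 2 * ℓ - x.1) by ring, mul_neg, div_mul_cancel₀ _ hpos.ne']
      ring
    · show c.2 + ℓ / (c.1 + 2 * ℓ - x.1) * (x.2 - c.2) = c.2 + ℓ * (x.2 - c.2) / (c.1 + 2 * ℓ - x.1)
      rw [div_mul_eq_mul_div]
  · rw [abs_lt] at hx'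
    constructor
    · have : -ℓ < ℓ * (x.2 - c.2) / (c.1 + 2 * ℓ - x.1) := by
        rw [lt_div_iff₀ hpos]; nlinarith
      linarith
    · have : ℓ * (x.2 - c.2) / (c.1 + 2 * ℓ - x.1) < ℓ := by
        rw [div_lt_iff₀ hpos]; nlinarith
      linarith

/-- On the edge itself both projections are the identity. [folklore] -/
theorem proj_edgePt (hℓ : 0 < ℓ) (hs : s ∈ Ioo (c.2 - ℓ) (c.2 + ℓ)) :
    proj c ℓ (edgePt c ℓ s) = edgePt c ℓ s ∧ proj (rightCenter c ℓ) ℓ (edgePt c ℓ s) = edgePt c ℓ s :=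
  ⟨proj_of_mem_sphere hℓ (edgePt_mem_sphere hℓ hs), proj_of_mem_sphere hℓ (edgePt_mem_sphere' hℓ hs)⟩

/-- Floor apex: the projection of `levelPt` (heights above the apex). [folklore] -/
theorem proj_levelPt_floor {q : ℝ × ℝ} (hℓ : 0 < ℓ) (hq : q ∈ sphere c ℓ) (hm : m < ψ q) (hh : m < h) :
    proj c ℓ (levelPt c m ψ q h) = q := by
  rw [← levelPt_neg c m ψ q h]
  exact proj_levelPt (ψ := fun y ↦ -ψ y) hℓ hq (by linarith) (by linarith)

/-! ## The glued maps -/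

section Glue

variable (c ℓ m m' ψ ψ' σ)

/-- The glued projection to the edge. [folklore] -/
def edgeProj (x : ℝ × ℝ) : ℝ × ℝ := if x.1 ≤ c.1 + ℓ then proj c ℓ x else proj (rightCenter c ℓ) ℓ x

/-- **The glued height**: the cone height of `Q` on the left, the converted cone height of `Q'`
on the right. [folklore] -/
def edgeHt (x : ℝ × ℝ) : ℝ :=
  if x.1 ≤ c.1 + ℓ then coneHt c ℓ m ψ x else σ (coneHt (rightCenter c ℓ) ℓ m' ψ' x)

/-- The inverse of the edge chart. [folklore] -/
def edgeInv (p : ℝ × ℝ) : ℝ × ℝ :=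
  if ψ (edgePt c ℓ p.1) ≤ p.2 then levelPt c m ψ (edgePt c ℓ p.1) p.2
  else levelPt (rightCenter c ℓ) m' ψ' (edgePt c ℓ p.1) (σ.symm p.2)

end Glue

/-- **The edge chart data.** Roof on `Q`, floor on `Q'`, continuous boundary heights, and the
compatibility `ψ = σ ∘ ψ'` along the closed edge. [folklore] -/
structure EdgeData (c : ℝ × ℝ) (ℓ m m' : ℝ) (ψ ψ' : ℝ × ℝ → ℝ) (σ : ℝ ≃o ℝ) : Prop where
  hℓ : 0 < ℓ
  roof : ∀ q ∈ sphere c ℓ, ψ q < m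
  floor : ∀ q ∈ sphere (rightCenter c ℓ) ℓ, m' < ψ' q
  cont : ContinuousOn ψ (sphere c ℓ)
  cont' : ContinuousOn ψ' (sphere (rightCenter c ℓ) ℓ)
  compat : ∀ s ∈ Icc (c.2 - ℓ) (c.2 + ℓ), ψ (edgePt c ℓ s) = σ (ψ' (edgePt c ℓ s))

namespace EdgeData

variable (E : EdgeData c ℓ m m' ψ ψ' σ)
include E

/-- Along the open edge, `ψ` exceeds the converted floor apex. [folklore] -/
theorem sigma_lt_psi (hs : s ∈ Ioo (c.2 - ℓ) (c.2 + ℓ)) : σ m' < ψ (edgePt c ℓ s) := by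
  rw [E.compat s ⟨hs.1.le, hs.2.le⟩]
  exact σ.strictMono (E.floor _ (edgePt_mem_sphere' E.hℓ hs))

/-- **The edge chart maps the diamond into the rectangle.** [folklore] -/
theorem mapsTo_edge (hx : x ∈ edgeDiamond c ℓ) :
    ((edgeProj c ℓ x).2, edgeHt c ℓ m m' ψ ψ' σ x) ∈ Ioo (c.2 - ℓ) (c.2 + ℓ) ×ˢ Ioo (σ m') m := by
  by_cases hside : x.1 ≤ c.1 + ℓ
  · obtain ⟨-, -, hxQ, hxc, hproj, hsI⟩ := left_fan E.hℓ hx hside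
    simp only [edgeProj, edgeHt, if_pos hside]
    refine ⟨by rw [hproj]; exact hsI, ?_, coneHt_lt_apex E.hℓ E.roof hxc⟩
    have h1 := le_coneHt E.hℓ E.roof hxQ
    rw [hproj] at h1
    exact (E.sigma_lt_psi hsI).trans_le h1
  · push Not at hside
    obtain ⟨-, -, hxQ, hxc, hproj, hsI⟩ := right_fan E.hℓ hx hside.le
    simp only [edgeProj, edgeHt, if_neg (not_le.2 hside)]
    refine ⟨by rw [hproj]; exact hsI, σ.strictMono (apex_lt_coneHt E.hℓ E.floor hxc), ?_⟩
    have h1 := coneHt_le E.hℓ E.floor hxQ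
    rw [hproj] at h1
    have h2 : σ (coneHt (rightCenter c ℓ) ℓ m' ψ' x) ≤ σ (ψ' (edgePt c ℓ _)) := σ.monotone h1
    rw [← E.compat _ ⟨hsI.1.le, hsI.2.le⟩] at h2
    exact h2.trans_lt (E.roof _ (edgePt_mem_sphere E.hℓ hsI))

/-- **The inverse maps the rectangle into the diamond**, to the correct side. [folklore] -/
theorem mapsTo_inv {p : ℝ × ℝ} (hp : p ∈ Ioo (c.2 - ℓ) (c.2 + ℓ) ×ˢ Ioo (σ m') m) :
    edgeInv c ℓ m m' ψ ψ' σ p ∈ edgeDiamond c ℓ ∧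
      (ψ (edgePt c ℓ p.1) ≤ p.2 → (edgeInv c ℓ m m' ψ ψ' σ p).1 ≤ c.1 + ℓ) ∧
      (p.2 < ψ (edgePt c ℓ p.1) → c.1 + ℓ < (edgeInv c ℓ m m' ψ ψ' σ p).1) := by
  obtain ⟨hs, hh⟩ := hp
  have hℓ := E.hℓ
  have hq := edgePt_mem_sphere hℓ hs (c := c)
  have hq' := edgePt_mem_sphere' hℓ hs (c := c)
  have hψm : ψ (edgePt c ℓ p.1) < m := E.roof _ hq
  by_cases hcase : ψ (edgePt c ℓ p.1) ≤ p.2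
  · -- left side: the level point on the ray of `Q` to the edge point
    simp only [edgeInv, if_pos hcase]
    set t := (m - p.2) / (m - ψ (edgePt c ℓ p.1)) with ht
    have ht0 : 0 < t := div_pos (by linarith [hh.2]) (by linarith)
    have ht1 : t ≤ 1 := (div_le_one (by linarith)).2 (by linarith)
    have hpt : levelPt c m ψ (edgePt c ℓ p.1) p.2 = (c.1 + t * ℓ, c.2 + t * (p.1 - c.2)) := by
      rw [levelPt, ← ht]
      ext
      · show c.1 + t * ((c.1 + ℓ) - c.1) = c.1 + t * ℓ; ring
      · rfl
    rw [hpt]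
    refine ⟨?_, fun _ ↦ by simp only; nlinarith, fun h ↦ absurd hcase (not_le.2 h)⟩
    show |c.2 + t * (p.1 - c.2) - c.2| < min (c.1 + t * ℓ - c.1) (c.1 + 2 * ℓ - (c.1 + t * ℓ))
    rw [show c.2 + t * (p.1 - c.2) - c.2 = t * (p.1 - c.2) by ring, abs_mul, abs_of_pos ht0]
    have hs' : |p.1 - c.2| < ℓ := abs_lt.2 ⟨by linarith [hs.1], by linarith [hs.2]⟩
    refine lt_min ?_ ?_
    · rw [show c.1 + t * ℓ - c.1 = t * ℓ by ring]; exact mul_lt_mul_of_pos_left hs' ht0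
    · have : t * |p.1 - c.2| < t * ℓ := mul_lt_mul_of_pos_left hs' ht0
      nlinarith
  · -- right side: the level point on the ray of `Q'` to the edge point
    push Not at hcase
    simp only [edgeInv, if_neg (not_le.2 hcase)]
    have hh' : m' < σ.symm p.2 := by
      rw [← σ.lt_iff_lt, σ.apply_symm_apply]; exact hh.1
    have hψ' : σ.symm p.2 < ψ' (edgePt c ℓ p.1) := by
      rw [← σ.lt_iff_lt, σ.apply_symm_apply, ← E.compat _ ⟨hs.1.le, hs.2.le⟩]; exact hcase
    have hm'ψ' : m' < ψ' (edgePt c ℓ p.1) := E.floor _ hq'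
    set t := (m' - σ.symm p.2) / (m' - ψ' (edgePt c ℓ p.1)) with ht
    have ht0 : 0 < t := div_pos_of_neg_of_neg (by linarith) (by linarith)
    have ht1 : t < 1 := (div_lt_one_of_neg (by linarith)).2 (by linarith)
    have hpt : levelPt (rightCenter c ℓ) m' ψ' (edgePt c ℓ p.1) (σ.symm p.2) =
        (c.1 + 2 * ℓ - t * ℓ, c.2 + t * (p.1 - c.2)) := by
      rw [levelPt, ← ht]
      ext
      · show c.1 + 2 * ℓ + t * ((c.1 + ℓ) - (c.1 + 2 * ℓ)) = c.1 + 2 * ℓ - t * ℓ; ring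
      · rfl
    rw [hpt]
    refine ⟨?_, fun h ↦ absurd h (not_le.2 hcase), fun _ ↦ by simp only; nlinarith⟩
    show |c.2 + t * (p.1 - c.2) - c.2| < min (c.1 + 2 * ℓ - t * ℓ - c.1) (c.1 + 2 * ℓ - (c.1 + 2 * ℓ - t * ℓ))
    rw [show c.2 + t * (p.1 - c.2) - c.2 = t * (p.1 - c.2) by ring, abs_mul, abs_of_pos ht0]
    have hs' : |p.1 - c.2| < ℓ := abs_lt.2 ⟨by linarith [hs.1], by linarith [hs.2]⟩
    have h1 : t * |p.1 - c.2| < t * ℓ := mul_lt_mul_of_pos_left hs' ht0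
    refine lt_min ?_ ?_
    · nlinarith
    · rw [show c.1 + 2 * ℓ - (c.1 + 2 * ℓ - t * ℓ) = t * ℓ by ring]; exact h1

/-- **Left inverse**: `edgeInv ∘ edgeChart = id` on the diamond. [folklore] -/
theorem inv_edge (hx : x ∈ edgeDiamond c ℓ) :
    edgeInv c ℓ m m' ψ ψ' σ ((edgeProj c ℓ x).2, edgeHt c ℓ m m' ψ ψ' σ x) = x := by
  have hℓ := E.hℓ
  by_cases hside : x.1 ≤ c.1 + ℓ
  · obtain ⟨-, -, hxQ, hxc, hproj, hsI⟩ := left_fan hℓ hx hside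
    simp only [edgeProj, edgeHt, if_pos hside]
    have hedge : edgePt c ℓ (proj c ℓ x).2 = proj c ℓ x := by rw [hproj]; rfl
    have hcond : ψ (edgePt c ℓ (proj c ℓ x).2) ≤ coneHt c ℓ m ψ x := by
      rw [hedge]; exact le_coneHt hℓ E.roof hxQ
    rw [edgeInv, if_pos hcond, hedge]
    exact levelPt_proj_coneHt hℓ E.roof x
  · push Not at hside
    obtain ⟨hdist, hpos, hxQ, hxc, hproj, hsI⟩ := right_fan hℓ hx hside.le
    simp only [edgeProj, edgeHt, if_neg (not_le.2 hside)]
    have hedge : edgePt c ℓ (proj (rightCenter c ℓ) ℓ x).2 = proj (rightCenter c ℓ) ℓ x := by rw [hproj]; rfl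
    -- strictly below the edge height: `x` is in the open ball of `Q'`
    have hxball : x ∈ ball (rightCenter c ℓ) ℓ := by
      rw [mem_ball, hdist]; linarith
    have hlt : coneHt (rightCenter c ℓ) ℓ m' ψ' x < ψ' (proj (rightCenter c ℓ) ℓ x) := by
      have hle := coneHt_le hℓ E.floor hxQ
      rcases hle.lt_or_eq with h | h
      · exact h
      · exfalso
        have hx' : x = levelPt (rightCenter c ℓ) m' ψ' (proj (rightCenter c ℓ) ℓ x) (coneHt (rightCenter c ℓ) ℓ m' ψ' x) :=
          eq_levelPt_of_coneHt_eq_floor hℓ E.floor rfl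
        have hq := proj_mem_sphere hℓ x (c := rightCenter c ℓ)
        have hmem : levelPt (rightCenter c ℓ) m' ψ' (proj (rightCenter c ℓ) ℓ x) (coneHt (rightCenter c ℓ) ℓ m' ψ' x) ∈
            sphere (rightCenter c ℓ) ℓ :=
          (levelPt_mem_sphere_iff_floor hℓ hq (E.floor _ hq) (apex_lt_coneHt hℓ E.floor hxc).le).2 h.symm
        rw [← hx', mem_sphere] at hmem
        rw [mem_ball] at hxball
        exact absurd hmem (ne_of_lt hxball)
    have hcond : ¬ ψ (edgePt c ℓ (proj (rightCenter c ℓ) ℓ x).2) ≤ σ (coneHt (rightCenter c ℓ) ℓ m' ψ' x) := by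
      rw [hedge, hproj, E.compat _ ⟨hsI.1.le, hsI.2.le⟩, not_le]
      apply σ.strictMono
      rw [← hproj]; exact hlt
    rw [edgeInv, if_neg hcond, hedge, σ.symm_apply_apply]
    exact (eq_levelPt_of_coneHt_eq_floor hℓ E.floor rfl).symm

/-- **Right inverse**: `edgeChart ∘ edgeInv = id` on the rectangle. [folklore] -/
theorem edge_inv {p : ℝ × ℝ} (hp : p ∈ Ioo (c.2 - ℓ) (c.2 + ℓ) ×ˢ Ioo (σ m') m) :
    ((edgeProj c ℓ (edgeInv c ℓ m m' ψ ψ' σ p)).2, edgeHt c ℓ m m' ψ ψ' σ (edgeInv c ℓ m m' ψ ψ' σ p)) = p := by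
  have hℓ := E.hℓ
  obtain ⟨hs, hh⟩ := hp
  have hq := edgePt_mem_sphere hℓ hs (c := c)
  have hq' := edgePt_mem_sphere' hℓ hs (c := c)
  obtain ⟨-, hleft, hright⟩ := E.mapsTo_inv ⟨hs, hh⟩
  by_cases hcase : ψ (edgePt c ℓ p.1) ≤ p.2
  · have hside := hleft hcase
    simp only [edgeProj, edgeHt, if_pos hside]
    simp only [edgeInv, if_pos hcase] at hside ⊢
    rw [proj_levelPt hℓ hq (E.roof _ hq) hh.2, coneHt_levelPt hℓ hq (E.roof _ hq) hh.2.le]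
    rfl
  · push Not at hcase
    have hside := hright hcase
    simp only [edgeProj, edgeHt, if_neg (not_le.2 hside)]
    simp only [edgeInv, if_neg (not_le.2 hcase)] at hside ⊢
    have hh' : m' < σ.symm p.2 := by rw [← σ.lt_iff_lt, σ.apply_symm_apply]; exact hh.1
    rw [proj_levelPt_floor hℓ hq' (E.floor _ hq') hh', coneHt_levelPt_floor hℓ hq' (E.floor _ hq') hh'.le,
      σ.apply_symm_apply]
    rfl

/-- **Continuity of the edge chart on the diamond** (the two branches agree on the edge).
[folklore] -/
theorem continuousOn_edge :
    ContinuousOn (fun x ↦ ((edgeProj c ℓ x).2, edgeHt c ℓ m m' ψ ψ' σ x)) (edgeDiamond c ℓ) := by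
  have hℓ := E.hℓ
  -- agreement on the edge
  have hagree : ∀ x ∈ edgeDiamond c ℓ, x.1 = c.1 + ℓ →
      (proj c ℓ x = x ∧ proj (rightCenter c ℓ) ℓ x = x) ∧
        coneHt c ℓ m ψ x = σ (coneHt (rightCenter c ℓ) ℓ m' ψ' x) := by
    intro x hx hx1
    have hxd : |x.2 - c.2| < ℓ := by
      have h0 : |x.2 - c.2| < min (x.1 - c.1) (c.1 + 2 * ℓ - x.1) := hx
      have := lt_of_lt_of_le h0 (min_le_left _ _); rw [hx1] at this; linarith [this]
    have hs : x.2 ∈ Ioo (c.2 - ℓ) (c.2 + ℓ) := by rw [abs_lt] at hxd; exact ⟨by linarith [hxd.1], by linarith [hxd.2]⟩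
    have hxeq : x = edgePt c ℓ x.2 := by rw [edgePt, ← hx1]
    have hq : x ∈ sphere c ℓ := hxeq ▸ edgePt_mem_sphere hℓ hs
    have hq' : x ∈ sphere (rightCenter c ℓ) ℓ := hxeq ▸ edgePt_mem_sphere' hℓ hs
    refine ⟨⟨proj_of_mem_sphere hℓ hq, proj_of_mem_sphere hℓ hq'⟩, ?_⟩
    rw [coneHt_of_mem_sphere hℓ hq, coneHt_of_mem_sphere hℓ hq']
    have := E.compat x.2 ⟨hs.1.le, hs.2.le⟩
    rwa [← hxeq] at this
  -- the four continuous pieces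
  have hL1 : ContinuousOn (fun x ↦ (proj c ℓ x).2) (edgeDiamond c ℓ ∩ closure {x : ℝ × ℝ | x.1 ≤ c.1 + ℓ}) := by
    refine (continuous_snd.comp_continuousOn (continuousOn_proj c ℓ)).mono ?_
    rintro x ⟨hx, hxc⟩
    rw [closure_le_eq continuous_fst continuous_const] at hxc
    exact (left_fan hℓ hx hxc).2.2.2.1
  have hR1 : ContinuousOn (fun x ↦ (proj (rightCenter c ℓ) ℓ x).2) (edgeDiamond c ℓ ∩ closure {x : ℝ × ℝ | ¬x.1 ≤ c.1 + ℓ}) := by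
    refine (continuous_snd.comp_continuousOn (continuousOn_proj (rightCenter c ℓ) ℓ)).mono ?_
    rintro x ⟨hx, hxc⟩
    have hxc' : c.1 + ℓ ≤ x.1 := by
      simp only [not_le] at hxc
      exact closure_lt_subset_le continuous_const continuous_fst hxc
    exact (right_fan hℓ hx hxc').2.2.2.1
  have hL2 : ContinuousOn (coneHt c ℓ m ψ) (edgeDiamond c ℓ ∩ closure {x : ℝ × ℝ | x.1 ≤ c.1 + ℓ}) := by
    refine (continuousOn_coneHt hℓ E.cont).mono ?_
    rintro x ⟨hx, hxc⟩
    rw [closure_le_eq continuous_fst continuous_const] at hxc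
    exact (left_fan hℓ hx hxc).2.2.2.1
  have hR2 : ContinuousOn (fun x ↦ σ (coneHt (rightCenter c ℓ) ℓ m' ψ' x))
      (edgeDiamond c ℓ ∩ closure {x : ℝ × ℝ | ¬x.1 ≤ c.1 + ℓ}) := by
    refine σ.continuous.comp_continuousOn ((continuousOn_coneHt hℓ E.cont').mono ?_)
    rintro x ⟨hx, hxc⟩
    have hxc' : c.1 + ℓ ≤ x.1 := by
      simp only [not_le] at hxc
      exact closure_lt_subset_le continuous_const continuous_fst hxc
    exact (right_fan hℓ hx hxc').2.2.2.1
  have hfr : ∀ x ∈ edgeDiamond c ℓ ∩ frontier {x : ℝ × ℝ | x.1 ≤ c.1 + ℓ}, x.1 = c.1 + ℓ := by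
    rintro x ⟨-, hx⟩
    have := frontier_le_subset_eq continuous_fst continuous_const hx
    exact this
  have hfst : (fun x ↦ (edgeProj c ℓ x).2) = fun x ↦ if x.1 ≤ c.1 + ℓ then (proj c ℓ x).2 else (proj (rightCenter c ℓ) ℓ x).2 := by
    funext x; simp only [edgeProj, apply_ite Prod.snd]
  refine ContinuousOn.prodMk ?_ ?_
  · rw [hfst]
    refine ContinuousOn.if (fun x hx ↦ ?_) hL1 hR1
    obtain ⟨⟨h1, h2⟩, -⟩ := hagree x hx.1 (hfr x hx)
    rw [h1, h2]
  · show ContinuousOn (fun x ↦ if x.1 ≤ c.1 + ℓ then coneHt c ℓ m ψ x else σ (coneHt (rightCenter c ℓ) ℓ m' ψ' x)) _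
    refine ContinuousOn.if (fun x hx ↦ ?_) hL2 hR2
    exact (hagree x hx.1 (hfr x hx)).2

/-- **Continuity of the inverse on the rectangle** (the two branches agree where `h = ψ`).
[folklore] -/
theorem continuousOn_inv : ContinuousOn (edgeInv c ℓ m m' ψ ψ' σ) (Ioo (c.2 - ℓ) (c.2 + ℓ) ×ˢ Ioo (σ m') m) := by
  have hℓ := E.hℓ
  set R := Ioo (c.2 - ℓ) (c.2 + ℓ) ×ˢ Ioo (σ m') m with hR
  have hRo : IsOpen R := isOpen_Ioo.prod isOpen_Ioo
  have hedge : ∀ p ∈ R, edgePt c ℓ p.1 ∈ sphere c ℓ := fun p hp ↦ edgePt_mem_sphere hℓ hp.1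
  have hedge' : ∀ p ∈ R, edgePt c ℓ p.1 ∈ sphere (rightCenter c ℓ) ℓ := fun p hp ↦ edgePt_mem_sphere' hℓ hp.1
  have hept : Continuous (fun p : ℝ × ℝ ↦ edgePt c ℓ p.1) := by unfold edgePt; fun_prop
  have hψc : ContinuousOn (fun p : ℝ × ℝ ↦ ψ (edgePt c ℓ p.1)) R := E.cont.comp hept.continuousOn hedge
  -- the two branches are continuous on all of `R`
  have h1 : ContinuousOn (fun p : ℝ × ℝ ↦ levelPt c m ψ (edgePt c ℓ p.1) p.2) R :=
    (continuousOn_levelPt E.roof E.cont).comp (hept.continuousOn.prodMk continuous_snd.continuousOn)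
      fun p hp ↦ ⟨hedge p hp, mem_univ _⟩
  have h2 : ContinuousOn (fun p : ℝ × ℝ ↦ levelPt (rightCenter c ℓ) m' ψ' (edgePt c ℓ p.1) (σ.symm p.2)) R := by
    have hneg : ∀ q ∈ sphere (rightCenter c ℓ) ℓ, (fun y ↦ -ψ' y) q < -m' := fun q hq ↦ by
      simp only; linarith [E.floor q hq]
    have h := (continuousOn_levelPt (c := rightCenter c ℓ) hneg E.cont'.neg).comp
      (hept.continuousOn.prodMk ((continuous_neg.comp σ.symm.continuous).comp_continuousOn continuous_snd.continuousOn))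
      fun p hp ↦ ⟨hedge' p hp, mem_univ _⟩
    refine h.congr fun p _ ↦ ?_
    simp only [Function.comp_apply]
    exact (levelPt_neg (rightCenter c ℓ) m' ψ' (edgePt c ℓ p.1) (σ.symm p.2)).symm
  -- at frontier points of the condition inside `R`, `h = ψ`, where both branches give the edge point
  have hfr : ∀ p ∈ R ∩ frontier {p : ℝ × ℝ | ψ (edgePt c ℓ p.1) ≤ p.2}, ψ (edgePt c ℓ p.1) = p.2 := by
    rintro p ⟨hpR, hpf⟩
    by_contra hne
    rcases lt_or_gt_of_ne hne with hlt | hgt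
    · -- strict inequality persists near `p` inside `R`: `p` is interior
      have hev : ∀ᶠ p' in 𝓝 p, ψ (edgePt c ℓ p'.1) < p'.2 := by
        have hc : ContinuousAt (fun p' : ℝ × ℝ ↦ p'.2 - ψ (edgePt c ℓ p'.1)) p :=
          ((continuous_snd.continuousOn.sub hψc).continuousAt (hRo.mem_nhds hpR))
        have := hc.eventually (Ioi_mem_nhds (sub_pos.2 hlt))
        exact this.mono fun p' hp' ↦ sub_pos.1 hp'
      have hint : p ∈ interior {p : ℝ × ℝ | ψ (edgePt c ℓ p.1) ≤ p.2} :=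
        mem_interior_iff_mem_nhds.2 (hev.mono fun p' hp' ↦ hp'.le)
      exact hpf.2 hint
    · have hev : ∀ᶠ p' in 𝓝 p, p'.2 < ψ (edgePt c ℓ p'.1) := by
        have hc : ContinuousAt (fun p' : ℝ × ℝ ↦ ψ (edgePt c ℓ p'.1) - p'.2) p :=
          ((hψc.sub continuous_snd.continuousOn).continuousAt (hRo.mem_nhds hpR))
        have := hc.eventually (Ioi_mem_nhds (sub_pos.2 hgt))
        exact this.mono fun p' hp' ↦ sub_pos.1 hp'
      have hmem : {p' : ℝ × ℝ | ψ (edgePt c ℓ p'.1) ≤ p'.2}ᶜ ∈ 𝓝 p :=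
        hev.mono fun p' hp' hle ↦ absurd (hp'.trans_le hle) (lt_irrefl _)
      obtain ⟨w, hw₁, hw₂⟩ := mem_closure_iff_nhds.1 hpf.1 _ hmem
      exact hw₁ hw₂
  refine ContinuousOn.if (fun p hp ↦ ?_) (h1.mono inter_subset_left) (h2.mono inter_subset_left)
  have heq := hfr p hp
  have hpR := hp.1
  have hq := hedge p hpR
  have hq' := hedge' p hpR
  -- both branches are the edge point
  rw [← heq]
  have hl : levelPt c m ψ (edgePt c ℓ p.1) (ψ (edgePt c ℓ p.1)) = edgePt c ℓ p.1 := by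
    rw [levelPt, div_self (by linarith [E.roof _ hq]), one_smul, add_sub_cancel]
  have hr : levelPt (rightCenter c ℓ) m' ψ' (edgePt c ℓ p.1) (σ.symm (ψ (edgePt c ℓ p.1))) = edgePt c ℓ p.1 := by
    rw [E.compat _ ⟨hpR.1.1.le, hpR.1.2.le⟩, σ.symm_apply_apply, levelPt,
      div_self (by linarith [E.floor _ hq']), one_smul, add_sub_cancel]
  rw [hl, hr]

/-- **The edge chart**: an open partial homeomorphism of the plane from the diamond onto the
open rectangle, whose height coordinate is the glued height `Ĥ`. [folklore] -/
def edgeChart (E : EdgeData c ℓ m m' ψ ψ' σ) : OpenPartialHomeomorph (ℝ × ℝ) (ℝ × ℝ) where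
  toFun x := ((edgeProj c ℓ x).2, edgeHt c ℓ m m' ψ ψ' σ x)
  invFun := edgeInv c ℓ m m' ψ ψ' σ
  source := edgeDiamond c ℓ
  target := Ioo (c.2 - ℓ) (c.2 + ℓ) ×ˢ Ioo (σ m') m
  map_source' _ hx := E.mapsTo_edge hx
  map_target' _ hp := (E.mapsTo_inv hp).1
  left_inv' _ hx := E.inv_edge hx
  right_inv' _ hp := E.edge_inv hp
  open_source := isOpen_edgeDiamond c ℓ
  open_target := isOpen_Ioo.prod isOpen_Ioo
  continuousOn_toFun := E.continuousOn_edge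
  continuousOn_invFun := E.continuousOn_inv

/-- The source of the edge chart is the diamond. [folklore] -/
@[simp] theorem edgeChart_source : E.edgeChart.source = edgeDiamond c ℓ := rfl

/-- The target of the edge chart is the rectangle. [folklore] -/
@[simp] theorem edgeChart_target : E.edgeChart.target = Ioo (c.2 - ℓ) (c.2 + ℓ) ×ˢ Ioo (σ m') m := rfl

/-- **The height coordinate of the edge chart is the glued height.** [folklore] -/
theorem edgeChart_snd (x : ℝ × ℝ) : (E.edgeChart x).2 = edgeHt c ℓ m m' ψ ψ' σ x := rfl

omit E in
/-- On the left half the glued height is the cone height of `Q`. [folklore] -/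
theorem edgeHt_of_le (hx : x.1 ≤ c.1 + ℓ) : edgeHt c ℓ m m' ψ ψ' σ x = coneHt c ℓ m ψ x := if_pos hx

omit E in
/-- On the right half the glued height is the converted cone height of `Q'`. [folklore] -/
theorem edgeHt_of_lt (hx : c.1 + ℓ < x.1) : edgeHt c ℓ m m' ψ ψ' σ x = σ (coneHt (rightCenter c ℓ) ℓ m' ψ' x) :=
  if_neg (not_le.2 hx)

/-- **The open edge lies in the diamond.** [folklore] -/
theorem edgePt_mem_edgeDiamond (hs : s ∈ Ioo (c.2 - ℓ) (c.2 + ℓ)) : edgePt c ℓ s ∈ edgeDiamond c ℓ := by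
  have hℓ := E.hℓ
  show |s - c.2| < min (c.1 + ℓ - c.1) (c.1 + 2 * ℓ - (c.1 + ℓ))
  rw [show c.1 + ℓ - c.1 = ℓ by ring, show c.1 + 2 * ℓ - (c.1 + ℓ) = ℓ by ring, min_self]
  exact abs_lt.2 ⟨by linarith [hs.1], by linarith [hs.2]⟩

end EdgeData

end ConeSquare

end Literature.Topology.FourManifolds
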